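import Summits.Ventures.PercRepro.Night2LocalD2OnePair
import Summits.Ventures.PercRepro.Night2LocalD2FarPairs

/-!
# PercRepro — the far preimages of a shadow set in the (6,4) cell `|E ∖ G| = 2` (night-2, gen 15)

Structural lemmas for the pair-5 programme of the `k = 0` cell (proofs/NIGHT-2-k0.md): at a shadow set `S` with
closure `G` (`G ∈ flatsQ M 5`, `|E ∖ G| = 2`), write `Zᵢ := G ∖ cl Bᵢ` (a 2-set) and `Hᵢ := cl Bᵢ` for the far
preimages `Bᵢ` of `S` (`S = Bᵢ ∪ Zᵢ`, `opFarPre` of Night2LocalD2OnePair).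

* `four_le_rkN_sdiff_of_mem_membersIn` — every member `B` has `ρ(G ∖ B) ≥ 4` (`ρ(E ∖ B) = 6 ≤ 2 + ρ(G ∖ B)`).
* `rkN_inter_clF_le_three_of_opFarPre` — two distinct far preimages have `ρ(H₁ ∩ H₂) ≤ 3`.
* `not_sdiff_subset_inter_of_two_far` — for two distinct far preimages and ANY pair preimage `B'` of `S`, the pair
  `S ∖ B'` is not contained in `H₁ ∩ H₂` (else `G ∖ B' = (G ∖ S) ∪ (S ∖ B') ⊆ H₁ ∩ H₂` has rank `≤ 3 < 4`).

The companion file Night2LocalD2FarTriangle draws the consequences: three far preimages form a series triangle when no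
`C ⊆ G` with `|C| ≤ 4` has `ρ(G ∖ C) ≤ 2`.
-/

namespace PercRepro.Shadow

open Finset PerFlat ThmH

variable {α : Type*} [DecidableEq α] {M : Matroid α} [M.Finite]

/-! ## Members -/

/-- A member below a flat `G` with `|E ∖ G| = 2` has `ρ(G ∖ B) ≥ 4`. -/
theorem four_le_rkN_sdiff_of_mem_membersIn {G : Finset α} (hd : (gr M \ G).card = 2)
    {B : Finset α} (hB : B ∈ membersIn M (Uq M (4 + 2) 4) G) : 4 ≤ rkN M (G \ B) := by
  have hBU : B ∈ Uq M (4 + 2) 4 := (mem_membersIn.1 hB).1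
  have h6 := rkN_sdiff_eq_of_mem_Uq hBU
  have hsub : gr M \ B ⊆ (G \ B) ∪ (gr M \ G) := by
    intro e he
    rw [Finset.mem_sdiff] at he
    rw [Finset.mem_union, Finset.mem_sdiff, Finset.mem_sdiff]
    by_cases heG : e ∈ G
    · left; exact ⟨heG, he.2⟩
    · right; exact ⟨he.1, heG⟩
  have h1 := rkN_mono (M := M) hsub
  have h2 := rkN_union_le_rkN_add_card (M := M) (G \ B) (gr M \ G)
  rw [hd] at h2
  omega

omit [DecidableEq α] in
/-- A set inside the closure of `Y` has rank at most `ρ(Y)`. -/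
theorem rkN_le_of_subset_clF' {X Y : Finset α} (h : X ⊆ clF M Y) : rkN M X ≤ rkN M Y := by
  have h1 := M.eRk_mono (show (X : Set α) ⊆ ((clF M Y : Finset α) : Set α) by exact_mod_cast h)
  rw [coe_clF, M.eRk_closure_eq, eRk_eq_rkN, eRk_eq_rkN] at h1
  exact_mod_cast h1

/-! ## Far preimages -/

open scoped Classical in
/-- Membership in `opFarPre`. -/
theorem mem_opFarPre {G S B : Finset α} :
    B ∈ opFarPre M G S ↔ B ∈ membersIn M (Uq M (4 + 2) 4) G ∧ (G \ clF M B).card = 2 ∧ S = B ∪ (G \ clF M B) := by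
  unfold opFarPre
  rw [Finset.mem_filter]

open scoped Classical in
/-- A far preimage is a subset of `S`. -/
theorem subset_of_mem_opFarPre {G S B : Finset α} (hB : B ∈ opFarPre M G S) : B ⊆ S := by
  rw [(mem_opFarPre.1 hB).2.2]
  exact Finset.subset_union_left

open scoped Classical in
/-- `S ∖ B = G ∖ cl B` for a far preimage `B` of `S`. -/
theorem sdiff_eq_of_mem_opFarPre {G S B : Finset α} (hB : B ∈ opFarPre M G S) : S \ B = G \ clF M B := by
  obtain ⟨hBm, -, hS⟩ := mem_opFarPre.1 hB
  have hBU : B ∈ Uq M (4 + 2) 4 := (mem_membersIn.1 hBm).1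
  rw [hS, Finset.union_sdiff_left, Finset.sdiff_eq_self_iff_disjoint, Finset.disjoint_left]
  intro e he heB
  exact (Finset.mem_sdiff.1 he).2 (subset_clF hBU heB)

open scoped Classical in
/-- `B = S ∖ (G ∖ cl B)` for a far preimage `B` of `S`. -/
theorem eq_sdiff_of_mem_opFarPre {G S B : Finset α} (hB : B ∈ opFarPre M G S) : B = S \ (G \ clF M B) := by
  rw [← sdiff_eq_of_mem_opFarPre hB, Finset.sdiff_sdiff_eq_self (subset_of_mem_opFarPre hB)]

open scoped Classical in
/-- `G ∖ S ⊆ cl B` for a far preimage `B` of `S`. -/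
theorem sdiff_subset_clF_of_mem_opFarPre {G S B : Finset α} (hB : B ∈ opFarPre M G S) : G \ S ⊆ clF M B := by
  intro e he
  rw [Finset.mem_sdiff] at he
  by_contra hecl
  apply he.2
  rw [(mem_opFarPre.1 hB).2.2]
  exact Finset.mem_union_right _ (Finset.mem_sdiff.2 ⟨he.1, hecl⟩)

open scoped Classical in
/-- Two distinct far preimages of `S` have distinct pairs `G ∖ cl B`. -/
theorem sdiff_clF_ne_of_opFarPre {G S B₁ B₂ : Finset α} (h₁ : B₁ ∈ opFarPre M G S) (h₂ : B₂ ∈ opFarPre M G S)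
    (hne : B₁ ≠ B₂) : G \ clF M B₁ ≠ G \ clF M B₂ := by
  intro hZ
  apply hne
  rw [eq_sdiff_of_mem_opFarPre h₁, eq_sdiff_of_mem_opFarPre h₂, hZ]

open scoped Classical in
/-- Two distinct far preimages of `S` have `ρ(H₁ ∩ H₂) ≤ 3` (`Hᵢ = cl Bᵢ`). -/
theorem rkN_inter_clF_le_three_of_opFarPre {G : Finset α} (hG : G ∈ flatsQ M (4 + 1)) {S B₁ B₂ : Finset α}
    (h₁ : B₁ ∈ opFarPre M G S) (h₂ : B₂ ∈ opFarPre M G S) (hne : B₁ ≠ B₂) :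
    rkN M (clF M B₁ ∩ clF M B₂) ≤ 3 := by
  obtain ⟨hB₁, hm₁, -⟩ := mem_opFarPre.1 h₁
  obtain ⟨hB₂, hm₂, -⟩ := mem_opFarPre.1 h₂
  have hU₁ : B₁ ∈ Uq M (4 + 2) 4 := (mem_membersIn.1 hB₁).1
  have hU₂ : B₂ ∈ Uq M (4 + 2) 4 := (mem_membersIn.1 hB₂).1
  have hZne := sdiff_clF_ne_of_opFarPre h₁ h₂ hne
  obtain ⟨z, hz₁, hz₂⟩ : ∃ z ∈ G \ clF M B₁, z ∉ G \ clF M B₂ := by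
    by_contra hcon
    push Not at hcon
    apply hZne
    apply Finset.eq_of_subset_of_card_le hcon
    rw [hm₁, hm₂]
  have hzH₂ : z ∈ clF M B₂ := by
    by_contra h
    exact hz₂ (Finset.mem_sdiff.2 ⟨(Finset.mem_sdiff.1 hz₁).1, h⟩)
  have hrU : 5 ≤ rkN M (clF M B₁ ∪ clF M B₂) := by
    have h1 : insert z B₁ ⊆ clF M B₁ ∪ clF M B₂ :=
      Finset.insert_subset (Finset.mem_union_right _ hzH₂) ((subset_clF hU₁).trans Finset.subset_union_left)
    have h2 := rkN_insert_eq_of_mem_sdiff_clF hG hU₁ hz₁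
    have := rkN_mono (M := M) h1
    omega
  have hsub := rkN_submod (M := M) (clF M B₁) (clF M B₂)
  rw [rkN_clF_eq_of_mem_Uq hU₁, rkN_clF_eq_of_mem_Uq hU₂] at hsub
  omega

open scoped Classical in
/-- Membership in `pairPre`. -/
theorem mem_pairPre {q : ℕ} {G S B : Finset α} :
    B ∈ pairPre M q G S ↔ B ∈ membersIn M (Uq M (q + 2) q) G ∧
      ∃ P ∈ Finset.powersetCard 2 (G \ clF M B), S = B ∪ P := by
  unfold pairPre
  rw [Finset.mem_filter]

open scoped Classical in
/-- A pair preimage is a subset of `S`. -/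
theorem subset_of_mem_pairPre {q : ℕ} {G S B : Finset α} (hB : B ∈ pairPre M q G S) : B ⊆ S := by
  obtain ⟨-, P, -, rfl⟩ := mem_pairPre.1 hB
  exact Finset.subset_union_left

open scoped Classical in
/-- `S ∖ B` is a 2-set for a pair preimage `B` of `S`. -/
theorem card_sdiff_of_mem_pairPre {q : ℕ} {G S B : Finset α} (hB : B ∈ pairPre M q G S) : (S \ B).card = 2 := by
  obtain ⟨hBm, P, hP, rfl⟩ := mem_pairPre.1 hB
  have hBU : B ∈ Uq M (q + 2) q := (mem_membersIn.1 hBm).1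
  rw [Finset.mem_powersetCard] at hP
  have hsd : (B ∪ P) \ B = P := by
    rw [Finset.union_sdiff_left, Finset.sdiff_eq_self_iff_disjoint, Finset.disjoint_left]
    intro e heP heB
    exact (Finset.mem_sdiff.1 (hP.1 heP)).2 (subset_clF hBU heB)
  rw [hsd, hP.2]

open scoped Classical in
/-- **Two far preimages confine every pair preimage**: for distinct far preimages `B₁ ≠ B₂` of `S` and a pair
preimage `B'` of `S`, the pair `S ∖ B'` is not inside `H₁ ∩ H₂`. -/
theorem not_sdiff_subset_inter_of_two_far {G : Finset α} (hG : G ∈ flatsQ M (4 + 1)) (hd : (gr M \ G).card = 2)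
    {S B₁ B₂ : Finset α} (h₁ : B₁ ∈ opFarPre M G S) (h₂ : B₂ ∈ opFarPre M G S) (hne : B₁ ≠ B₂)
    {B' : Finset α} (hB' : B' ∈ pairPre M 4 G S) : ¬ (S \ B' ⊆ clF M B₁ ∩ clF M B₂) := by
  intro hsub
  have hB'm : B' ∈ membersIn M (Uq M (4 + 2) 4) G := (mem_pairPre.1 hB').1
  have h4 := four_le_rkN_sdiff_of_mem_membersIn hd hB'm
  have hcompl : G \ B' ⊆ clF M B₁ ∩ clF M B₂ := by
    intro e he
    rw [Finset.mem_sdiff] at he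
    by_cases heS : e ∈ S
    · exact hsub (Finset.mem_sdiff.2 ⟨heS, he.2⟩)
    · exact Finset.mem_inter.2 ⟨sdiff_subset_clF_of_mem_opFarPre h₁ (Finset.mem_sdiff.2 ⟨he.1, heS⟩),
        sdiff_subset_clF_of_mem_opFarPre h₂ (Finset.mem_sdiff.2 ⟨he.1, heS⟩)⟩
  have h3 := rkN_inter_clF_le_three_of_opFarPre hG h₁ h₂ hne
  have := rkN_mono (M := M) hcompl
  omega

end PercRepro.Shadow
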